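import Summits.QuantumFields.YangMills.Theorems.SqueezedSkewnessFemtoCeiling

/-!
# Crux `BalabanLadder.NT` (stmt-QuantumFields-19353), LINE τ «typical currency» (planner ym-idea-6 g14, published skeleton
# `Cruxes/NT/Lines/typical_currency_birth.lean`; critic idea-crit-9 VERDICT #72 PASS-WITH-PRICE):
# support T4 `stub_mirrorMenuOfQrpFloors : pre FemtoQrpFloors → MirrorMenu`, PROVED

Dictionary only: the femto `Qrp` bump floors of the unit (the fourth conjunct of `FemtoFloorUnit`, `Fin`-torus `let`-vocabulary) feed
RM₁'s `J = 1` finite-menu mirror floor (the hypothesis of `FiniteRankMirror.FemtoResponseMoments`, item 23837, `torusE`/`box` vocabulary):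
take radius `ρ = 1`, the translate `f = v(· + τe₀)` with `τ = δ₁ − 2h₁` (lower edge `2h₁ ∈ [h₁, 3h₁]`, so the floor applies and
`tsupport f ⊆ {y₀ ≥ 2h₁} ⊆ {y₀ > 0}`), and read `Qrp(f) = E_T[Φ_f∘Θ · Φ_f] − (E_T Φ_f)²` with `Φ_f = Σ_{y ∈ box} f(a·y)·dens_y` through the
landed reflected `Fin`-torus ↔ `torusE` dictionary (`AntipodalMarkovDictionary.covF_toFin_reflF`, `toFin_dens_zOf`,
`ThermalDescentTorusDictionary.sum_box_eq_sum_fin`) and reflection invariance (`torusE_comp_cfgReflect`) — the `key` step of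
`FemtoCeilingProof.femtoCeiling_proof` run backwards.  The statement is the skeleton's `__Registered.stub_mirrorMenuOfQrpFloors` with
`FemtoQrpFloors` / `MirrorMenu` unfolded (byte-identical bodies).

HONEST FRAMING: dictionary support; no crux, NT statement, rung or summit is proved; the Yang–Mills mass gap is NOT proved.
Cell `ym-idea-1`, LEAD seat `ym-line-sfw-p2` g71 (free hands), `--supports stmt-QuantumFields-19353 --as helper`. [folklore]
-/

set_option autoImplicit false

noncomputable section

open MeasureTheory Filter Topology
open Literature.MathematicalPhysics.QuantumFieldTheory Literature.MathematicalPhysics.QuantumLattice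
open Literature.Probability.LatticeModels (box)
open Summit.QuantumFields.YangMills.Cruxes.OSLegsFromFemtoAndGap.DlrCollarTransfer
open Summit.QuantumFields.YangMills.Theorems.ThermalDescentTorusDictionary (eF aF wF zOf ccZ sum_box_eq_sum_fin)
open Summit.QuantumFields.YangMills.Theorems.AntipodalMarkovDictionary (covF_toFin_reflF toFin_dens_zOf)
open Summit.QuantumFields.YangMills.Cruxes.NT.ConjugateResponse (torusE_comp_cfgReflect)

namespace Summit.QuantumFields.YangMills.Theorems.MirrorMenuOfQrpFloors

/-- **T4 `stub_mirrorMenuOfQrpFloors` of LINE τ**: the femto `Qrp` floors at `(G, r, a)` give RM₁'s `J = 1` mirror menu. [folklore] -/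
theorem mirrorMenu_of_femtoQrpFloors :
    ∀ (G : Type) [Group G] [TopologicalSpace G] [IsTopologicalGroup G] [CompactSpace G],
      Literature.MathematicalPhysics.QuantumFieldTheory.IsCompactSimpleLieGroup G → letI : MeasurableSpace G := borel G;
      haveI : BorelSpace G := ⟨rfl⟩; ∀ (r : Literature.MathematicalPhysics.QuantumFieldTheory.LatticeRep G) (a : ℝ → ℝ),
      (∀ β, 0 < a β) → Filter.Tendsto a Filter.atTop (nhds 0) →
      (let St : ℕ → ℕ → Type := fun S T => Literature.MathematicalPhysics.QuantumFieldTheory.FinTorusSite S S S T; let Cfg : ℕ → ℕ → Type := fun S T => Literature.MathematicalPhysics.QuantumFieldTheory.FinTorusSite S S S T × Fin 4 → G; let cc : (n : ℕ) → Fin n → ℤ := fun n i => if 2 * i.val < n then (i.val : ℤ) else (i.val : ℤ) - n; let posE : (S T : ℕ) → St S T → EuclideanSpace ℝ (Fin 4) := fun S T x => Literature.MathematicalPhysics.QuantumLattice.siteToE (d := 4) ![cc T x.2.2.2, cc S x.1, cc S x.2.1, cc S x.2.2.1]; let P : (S T : ℕ) → St S T → Fin 4 → Fin 4 → Cfg S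 T → ℝ := fun _ _ x i j U => (r.ρ (Literature.MathematicalPhysics.QuantumFieldTheory.finTorusPlaquette U x i j)).trace.re; let A : (S T : ℕ) → St S T → Cfg S T → ℝ := fun S T x U => ∑ q : {q : Fin 4 × Fin 4 // q.1 < q.2}, P S T x q.1.1 q.1.2 U; let w : ℝ → (S T : ℕ) → Cfg S T → ℝ := fun β S T U => Real.exp (-β * ∑ x : St S T, ∑ q : {q : Fin 4 × Fin 4 // q.1 < q.2}, ((r.N : ℝ) - P S T x q.1.1 q.1.2 U)); let E : ℝ → (S T : ℕ) → (Cfg S T → ℝ) → ℝ := fun β S T F => (∫ U : Literature.MathematicalPhysics.QuantumFieldTheory.FinTorusSite S S S T × Fin 4 → G, F U * w β S T U ∂MeasureTheory.Measure.pi (fun _ => Literature.MathematicalPhysics.QuantumFieldTheory.haarProbability G)) / Literature.MathematicalPhysics.QuantumFieldTheory.wilsonFinTorusPartition r.ρ β S S S T; let Cov : ℝ → (S T : ℕ) → (Cfg S T → ℝ) → (Cfg S T → ℝ) → ℝ := fun β S T F F' => E β S T (fun U => F U * F' U) - E β S T F * E β S T F'; let refl : (S T : ℕ) → Cfg S T →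 Cfg S T := fun _ T U e => if e.2 = Fin.last 3 then (U ((e.1.1, e.1.2.1, e.1.2.2.1, Fin.rev e.1.2.2.2), Fin.last 3))⁻¹ else U ((e.1.1, e.1.2.1, e.1.2.2.1, ⟨(T - e.1.2.2.2.val) % T, Nat.mod_lt _ e.1.2.2.2.pos⟩), e.2); let B : (S T : ℕ) → ℝ → SchwartzMap (EuclideanSpace ℝ (Fin 4)) ℝ → Cfg S T → ℝ := fun S T s f U => ∑ x : St S T, f (s • posE S T x) * A S T x U; let Qrp : ℝ → (S T : ℕ) → ℝ → SchwartzMap (EuclideanSpace ℝ (Fin 4)) ℝ → ℝ := fun β S T s f => Cov β S T (fun U => B S T s f (refl S T U)) (B S T s f); ∀ ρ : ℝ, 0 < ρ → ∃ (v : SchwartzMap (EuclideanSpace ℝ (Fin 4)) ℝ), (∀ x, 0 ≤ v x) ∧ tsupport (v : EuclideanSpace ℝ (Fin 4) → ℝ) ⊆ Metric.closedBall (EuclideanSpace.single (0 : Fin 4) (1 : ℝ)) ρ ∧ ∃ (δ₁ δ₂ h₁ ε β₅ Λ₅ : ℝ), 0 < δ₁ ∧ tsupport v ⊆ {y : EuclideanSpace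 ℝ (Fin 4) | δ₁ < y 0 ∧ y 0 < δ₂} ∧ 0 < h₁ ∧ 3 * h₁ ≤ δ₁ ∧ 0 < ε ∧ ∀ β : ℝ, β₅ ≤ β → ∀ L : ℕ, Λ₅ ≤ a β * L → ∀ (τ : ℝ) (f : SchwartzMap (EuclideanSpace ℝ (Fin 4)) ℝ), h₁ ≤ δ₁ - τ → δ₁ - τ ≤ 3 * h₁ → (∀ y, f y = v (y + τ • EuclideanSpace.single (0 : Fin 4) (1 : ℝ))) → ε ≤ Qrp β (2 * L + 1) (2 * L + 1) (a β) f) →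
      (∃ (J : ℕ) (v : Fin J → SchwartzMap (EuclideanSpace ℝ (Fin 4)) ℝ) (ε₀ β₀ Λ₀ : ℝ), (∀ j, tsupport (v j : EuclideanSpace ℝ (Fin 4) → ℝ) ⊆ {y | 0 < y 0}) ∧ 0 < ε₀ ∧ ∀ β : ℝ, β₀ ≤ β → ∀ L : ℕ, Λ₀ ≤ a β * L → ε₀ ≤ ∑ j, (torusE G r β L (fun V => (∑ y ∈ box 4 L, v j (a β • siteToE y) * dens G r y (cfgReflect V)) * ∑ y ∈ box 4 L, v j (a β • siteToE y) * dens G r y V) - torusE G r β L (fun V => ∑ y ∈ box 4 L, v j (a β • siteToE y) * dens G r y V) ^ 2)) := by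
  intro G _ _ _ _ hG r a ha ha0 hFl
  letI : MeasurableSpace G := borel G
  haveI : BorelSpace G := ⟨rfl⟩
  haveI := r.secondCountableTopology
  dsimp only at hFl
  obtain ⟨v, hv0, hball, δ₁, δ₂, h₁, ε, β₅, Λ₅, hδ₁, hslab, hh₁, h3h₁, hε, hfloor⟩ := hFl 1 one_pos
  -- the translate `f = v(· + τ e₀)` with lower edge `δ₁ − τ = 2h₁ ∈ [h₁, 3h₁]`
  set τ : ℝ := δ₁ - 2 * h₁ with hτ
  set e₀ : EuclideanSpace ℝ (Fin 4) := EuclideanSpace.single (0 : Fin 4) (1 : ℝ) with he₀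
  set f : SchwartzMap (EuclideanSpace ℝ (Fin 4)) ℝ := SchwartzMap.compSubConstCLM ℝ (-(τ • e₀)) v with hfdef
  have hfy : ∀ y, f y = v (y + τ • EuclideanSpace.single (0 : Fin 4) (1 : ℝ)) := fun y => by
    rw [hfdef, SchwartzMap.compSubConstCLM_apply, sub_neg_eq_add]
  have hsupp : tsupport (f : EuclideanSpace ℝ (Fin 4) → ℝ) ⊆ {y | 0 < y 0} := by
    have hcl : IsClosed {y : EuclideanSpace ℝ (Fin 4) | 2 * h₁ ≤ y 0} :=
      isClosed_le continuous_const ((EuclideanSpace.proj (0 : Fin 4)).continuous)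
    refine (closure_minimal (fun y hy => ?_) hcl).trans fun y hy => ?_
    · have hy' : v (y + τ • EuclideanSpace.single (0 : Fin 4) (1 : ℝ)) ≠ 0 := by rwa [Function.mem_support, hfy] at hy
      have hmem := (hslab (subset_tsupport _ (Function.mem_support.2 hy'))).1
      simp at hmem
      show 2 * h₁ ≤ y 0
      rw [hτ] at hmem; linarith
    · show 0 < y 0
      have : 2 * h₁ ≤ y 0 := hy
      linarith
  refine ⟨1, ![f], ε, β₅, Λ₅, fun j => by fin_cases j; exact hsupp, hε, fun β hβ L hL => ?_⟩
  have hfl := hfloor β hβ L hL τ f (by rw [hτ]; linarith) (by rw [hτ]; linarith) hfy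
  -- the route's `Qrp(f)` is the mirror covariance of `Φ = Σ_{y ∈ box} f(a·y)·dens y`
  set s : ℝ := a β with hs
  set c : FinTorusSite (2 * L + 1) (2 * L + 1) (2 * L + 1) (2 * L + 1) → ℝ :=
    fun u => f (s • siteToE (zOf (2 * L + 1) u)) with hcdef
  obtain ⟨Φ, hΦ⟩ : ∃ Φ : LGConfig 4 G → ℝ, Φ = fun V => ∑ y ∈ box 4 L, f (s • siteToE y) * dens G r y V := ⟨_, rfl⟩
  have hB : ∀ W : FinTorusSite (2 * L + 1) (2 * L + 1) (2 * L + 1) (2 * L + 1) × Fin 4 → G,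
      (∑ x, c x * aF r x W) =
        Φ (torusLift (2 * L + 1) (configPerm (finRotate 4) ((finTorusConfigEquivSite G (2 * L + 1)).symm W))) := by
    intro W
    rw [hΦ]
    dsimp only
    rw [sum_box_eq_sum_fin L]
    exact Finset.sum_congr rfl fun x _ => by rw [← congrFun (toFin_dens_zOf (G := G) r L x) W]
  have step : ε ≤ eF r β (2 * L + 1) (fun V => (∑ x, c x * aF r x (fun e => if e.2 = Fin.last 3 then (V ((e.1.1, e.1.2.1, e.1.2.2.1, Fin.rev e.1.2.2.2), Fin.last 3))⁻¹ else V ((e.1.1, e.1.2.1, e.1.2.2.1, ⟨((2 * L + 1) - e.1.2.2.2.val) % (2 * L + 1), Nat.mod_lt _ e.1.2.2.2.pos⟩), e.2))) * ∑ x, c x * aF r x V) -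
      eF r β (2 * L + 1) (fun V => ∑ x, c x * aF r x (fun e => if e.2 = Fin.last 3 then (V ((e.1.1, e.1.2.1, e.1.2.2.1, Fin.rev e.1.2.2.2), Fin.last 3))⁻¹ else V ((e.1.1, e.1.2.1, e.1.2.2.1, ⟨((2 * L + 1) - e.1.2.2.2.val) % (2 * L + 1), Nat.mod_lt _ e.1.2.2.2.pos⟩), e.2))) * eF r β (2 * L + 1) (fun V => ∑ x, c x * aF r x V) :=
    hfl
  simp only [hB] at step
  rw [covF_toFin_reflF (G := G) r β L Φ Φ, torusE_comp_cfgReflect G r β L Φ] at step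
  simp only [Fin.sum_univ_one, Matrix.cons_val_zero]
  rw [hΦ] at step
  rw [sq]
  exact step

end Summit.QuantumFields.YangMills.Theorems.MirrorMenuOfQrpFloors

end
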